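/-
Copyright (c) 2026 the pub-hodgecm-mathlib formalisation cell (harness21).  Prover seat hodgecm-mathlib-LH4-p08 (g12), req620 Track A «(D-RAM) FOUR-FRAME» squad
(STAGE-1b, row (2) of the piece `f_{T₊}`, the (β₂) road (R-36), the K6 road; K6 desk LH4-p16 (g3) WORD #13 (c) «(g-top) THE TOP-SPHERE NX SUM VANISHES» — the
ONE arithmetic input of the TOP cell in ★ p864591 `…CoreOfPerCellLaws.coreWindow_of_cellSums`), 2026-09-05.
-/
import Summits.HodgeConjecture.HodgeConjecture.Theorems.F0P3cDyRamWindowLabelSumVanishes   -- ★ p864489 (LH4-p11 (g11)) K6-(g): `sum_normSign_affine_filterBall_eq_zero`;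
                                                                                            -- brings ★ Lit `sum_normSign_repr_eq_zero`, `IsRamifiedQuadraticDatum`, `normSign`
import Literature.NumberTheory.LocalFields.WildQuadraticDatumNormOneQuotient                -- ★ Lit `two_le_of_v_two_lt_one` (a wild place has `2 ≤ d`)
import HarnessLib

/-!
# Crux `H413`, line LH4 «(D-RAM) FOUR-FRAME» — STAGE-1b, row (2), the (β₂) road (R-36), K6 (g-top): «THE TOP-SPHERE NX SUM VANISHES» — on the unit sphere of the
# top chart the affine label character `V ↦ ω(α₁ + γ₁·V)`, restricted to the digits whose value is a unit (`NX`), sums to zero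

Cell `hodgecm-mathlib` (D-0151), FLOOR 0, crux item H413 = `stmt-HodgeConjecture-24833`, route of record `HCCMUnconditional`; squad F0∕P3c∕LH4; lane
`--supports stmt-HodgeConjecture-24833 --as helper` (count-neutral; pays NO tier-0 row).  THEOREMS ONLY (no `def`, no instance, no notation, no `sorry`, default heartbeats);
★-only imports; states NO law; (β₂) stays a HYPOTHESIS.  ONE-FIELD local arithmetic of a ramified quadratic datum `(σ, ϖ; d, t)` on a complete `K` with finite residue field
(`F = K^σ` the fixed elements, `|ϖ_F| = |ϖ|²`, `ω = normSign σ`, `U_F(k)` = fixed units `u` with `|u − 1| ≤ |ϖ|^k`); nothing about lattices, no chart object, no second field.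

WHAT (K6 desk LH4-p16 (g3) WORD #13 (c)).  In the TOP chart of the live row the top cell `i = N` carries the unit SPHERE `|V| = 1` of the σ-fixed digits, with the affine label
`u = α₁ + γ₁·V`, `|α₁| = |γ₁| = 1`, and the level-0 token `NX V :⟺ |α₁ + γ₁·V| = 1`; its law reads `X_t(N)·#S_t = n_t·p_t·Σ_{V ∈ S_t, NX V} ω(α₁ + γ₁V)`, and the window identity
★ p864591 `coreWindow_of_cellSums` closes as soon as the TOTAL top-sphere NX sum vanishes.  THIS FILE proves exactly that, over ONE complete irredundant system `Rd` of σ-fixed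
integral digits modulo `|ϖ|^n` at any resolution reaching the conductor (`2d − 1 ≤ n`):
* §1 `sum_normSign_affine_filterUnit_eq_zero` — **`Σ_{V ∈ Rd.filter (|α₁ + γ₁V| = 1)} ω(α₁ + γ₁·V) = 0`** (`|α₁| ≤ 1`, `|γ₁| = 1`): `V ↦ α₁ + γ₁V` is an isometry of the fixed
  integral elements onto themselves, so the unit-valued digits map onto a complete irredundant system of representatives modulo `𝔭^n` of the set of ALL fixed units — a set
  stable under `U_F(2d−2)` — and ★ Lit `sum_normSign_repr_eq_zero` (the non-norm involution) kills the sum.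
* §2 `sum_filterUnit_eq_sum_filterSphere_add_sum_filterBall` — THE DIGIT SPLIT: for fixed integral digits, `|α₁ + γ₁V| = 1` holds iff (`|V| = 1` and `|α₁ + γ₁V| = 1`) or
  `|V| ≤ |ϖ|²` (fixed non-zero elements have EVEN valuation, so `|V| < 1 ⇒ |V| ≤ |ϖ|²`, and then `|α₁ + γ₁V| = |α₁| = 1` automatically); the two parts are disjoint.
* §3 HEAD `sum_normSign_affine_topSphere_eq_zero` — **`Σ_{V ∈ Rd.filter (fun V => |V| = 1 ∧ |α₁ + γ₁·V| = 1)} normSign σ (α₁ + γ₁·V) = 0`** = §1 minus ★ p864489 §3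
  `sum_normSign_affine_filterBall_eq_zero` at `e = 1, c = 0` (the small ball `|V| ≤ |ϖ|²` maps onto the coset ball `α₁(1 + 𝔭_F)`, which reaches `U_F(2d−2)` because
  `2 ≤ d` at a wild place — ★ Lit `two_le_of_v_two_lt_one`; NO extra floor).
WHAT IS NOT CLAIMED: which digits are labelled ∕ literal, the per-cell law of the top cell, any census identity, any chart letter; ‹CORE›∕‹CORE-3›∕‹CORE-ODD› and (β₂)
remain HYPOTHESES of their consumers.
HONEST LABEL.  Count-neutral local arithmetic; nothing printed is asserted; no census law is stated; `HC_CM` is proved only modulo the 7 printed citations (2 remaining named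
inputs: hLiu418 = `stmt-HodgeConjecture-24832`, h413 = `stmt-HodgeConjecture-24833`) until rung 0 closes.
## References
* [Serre1979] J.-P. Serre, *Local Fields*, GTM 67 (1979): Ch. V §3 Prop. 5, Cor. 2–3 pp. 84–86 (norm groups of a totally ramified quadratic extension; the conductor), Ch. XV §2
  (the conductor via `U^{(n)}`; a non-trivial character sums to zero over the cosets on which it is non-trivial).
* [NeukirchANT1999] J. Neukirch, *Algebraic Number Theory* (1999): Ch. V (1.3) (local norm index two).
* [Kottwitz1986BaseChangeUnits] R. E. Kottwitz, *Base change for unit elements of Hecke algebras*, Compositio Math. 60 (1986): §1 pp. 240–241 (cell-by-cell lattice bookkeeping).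
* [Rogawski1990] J. D. Rogawski, *Automorphic Representations of Unitary Groups in Three Variables*, Ann. of Math. Stud. 123 (1990): §4.9 Prop. 4.9.1 (b) p. 55 (the labelled census).
-/

set_option autoImplicit false

noncomputable section

namespace Summit.HodgeConjecture.HodgeConjecture.Cruxes.H413.F0P3cDyRamTopSphereLabelSumVanishes

open WithZero Finset
open scoped Valued
open Literature.NumberTheory.Automorphic.UnitaryThreeFourFrame (IsRamifiedQuadraticDatum normSign)
open Literature.NumberTheory.LocalFields.WildQuadraticDatum (sum_normSign_repr_eq_zero two_le_of_v_two_lt_one)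
open Summit.HodgeConjecture.HodgeConjecture.Cruxes.H413.F0P3cDyRamWindowLabelSumVanishes (sum_normSign_affine_filterBall_eq_zero)

variable {K : Type} [Field K] [Valued K ℤᵐ⁰] {σ : K →+* K} {ϖ : K} {d t : ℕ}

/-! ## §1 The unit-valued digits: an affine isometry carries a digit system of the integers onto one of the integers, units onto units -/

/-- **«THE AFFINE LABEL CHARACTER SUMS TO ZERO OVER THE UNIT-VALUED DIGITS».**  Ramified quadratic datum `(σ, ϖ; d, t)` on a complete `K` with finite residue field,
`|2| < 1`; `α₁, γ₁` fixed with `|α₁| ≤ 1`, `|γ₁| = 1`; a resolution `n` with `2d − 1 ≤ n`; `Rd` a finite set of fixed integral elements (`hRd1`) which is COMPLETE (`hRd2`) and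
IRREDUNDANT (`hRd3`) for the fixed integral elements modulo `|ϖ|^n`.  THEN **`Σ_{V ∈ Rd.filter (|α₁ + γ₁·V| = 1)} ω(α₁ + γ₁·V) = 0`** (`ω = normSign σ`): the isometry
`V ↦ α₁ + γ₁V` maps the unit-valued digits injectively onto a complete irredundant system of representatives modulo `𝔭^n` of the set of all fixed units (a representative
within `|ϖ|^n < 1` of a unit is a unit), that set is stable under multiplication by `U_F(2d−2)`, and ★ `sum_normSign_repr_eq_zero` applies.
[cite: Serre1979, Ch. V §3 Cor. 3 pp. 84–86; Ch. XV §2] [cite: NeukirchANT1999, Ch. V (1.3)] -/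
theorem sum_normSign_affine_filterUnit_eq_zero [CompleteSpace K] [Finite 𝓀[K]] (hD : IsRamifiedQuadraticDatum σ ϖ d t) (h2v : Valued.v (2 : K) < 1)
    {α₁ γ₁ : K} (hσα₁ : σ α₁ = α₁) (hα₁ : Valued.v α₁ ≤ 1) (hσγ₁ : σ γ₁ = γ₁) (hγ₁ : Valued.v γ₁ = 1) {n : ℕ} (hn : 2 * d - 1 ≤ n)
    (Rd : Finset K) (hRd1 : ∀ V ∈ Rd, σ V = V ∧ Valued.v V ≤ 1)
    (hRd2 : ∀ V : K, σ V = V → Valued.v V ≤ 1 → ∃ V₀ ∈ Rd, Valued.v (V - V₀) ≤ Valued.v ϖ ^ n)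
    (hRd3 : ∀ V ∈ Rd, ∀ V' ∈ Rd, Valued.v (V - V') ≤ Valued.v ϖ ^ n → V = V') :
    ∑ V ∈ Rd.filter (fun V => Valued.v (α₁ + γ₁ * V) = 1), normSign σ (α₁ + γ₁ * V) = 0 := by
  classical
  obtain ⟨-, -, hϖ, -, -, hd1, -⟩ := id hD
  -- `|ϖ|^n < 1`
  have hϖn : Valued.v ϖ ^ n < 1 := by
    rw [hϖ, ← exp_nsmul, nsmul_eq_mul, mul_neg, mul_one, ← exp_zero, exp_lt_exp]; omega
  have hγ0 : γ₁ ≠ 0 := fun h => by rw [h, map_zero] at hγ₁; exact zero_ne_one hγ₁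
  -- the set of all fixed units and its (trivial) stability
  set A : Set K := {u | σ u = u ∧ Valued.v u = 1} with hAdef
  have hAu : ∀ f ∈ A, σ f = f ∧ Valued.v f = 1 := fun f hf => hf
  have hAst : ∀ f ∈ A, ∀ a : K, σ a = a → Valued.v a = 1 → Valued.v (a - 1) ≤ exp (-(2 * ((d - 1 : ℕ) : ℤ))) → a * f ∈ A := by
    rintro f ⟨hσf, hf⟩ a hσa ha1 -
    exact ⟨by rw [map_mul, hσa, hσf], by rw [map_mul, ha1, hf, mul_one]⟩
  -- the representative map
  let g : K → K := fun V => α₁ + γ₁ * V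
  set D : Finset K := Rd.filter (fun V => Valued.v (α₁ + γ₁ * V) = 1) with hDdef
  have hg_inj : Set.InjOn g ↑D := by
    intro a _ a' _ h
    have h' : α₁ + γ₁ * a = α₁ + γ₁ * a' := h
    exact mul_left_cancel₀ hγ0 (add_left_cancel h')
  set S : Finset K := D.image g with hSdef
  have hS1 : ∀ y ∈ S, y ∈ A := by
    intro y hy
    obtain ⟨V, hV, rfl⟩ := mem_image.1 hy
    obtain ⟨hVR, hVu⟩ := mem_filter.1 hV
    exact ⟨by simp only [g, map_add, map_mul, hσα₁, hσγ₁, (hRd1 V hVR).1], hVu⟩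
  have hS2 : ∀ f ∈ A, ∃ y ∈ S, Valued.v (f - y) ≤ Valued.v ϖ ^ n := by
    rintro f ⟨hσf, hf⟩
    -- the coordinate `u := (f − α₁) ∕ γ₁` is a fixed integral element
    set u : K := (f - α₁) * γ₁⁻¹ with hu
    have hσu : σ u = u := by rw [hu, map_mul, map_inv₀, map_sub, hσf, hσα₁, hσγ₁]
    have hγu : γ₁ * u = f - α₁ := by rw [hu, mul_comm, mul_assoc, inv_mul_cancel₀ hγ0, mul_one]
    have hu1 : Valued.v u ≤ 1 := by
      rw [hu, map_mul, map_inv₀, hγ₁, inv_one, mul_one]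
      exact (Valuation.map_sub _ _ _).trans (max_le hf.le hα₁)
    obtain ⟨V₀, hV₀R, hV₀⟩ := hRd2 u hσu hu1
    have e1 : f - g V₀ = γ₁ * (u - V₀) := by simp only [g]; rw [mul_sub, hγu]; ring
    have hnear : Valued.v (f - g V₀) ≤ Valued.v ϖ ^ n := by
      rw [e1, map_mul, hγ₁, one_mul]; exact hV₀
    have hgu : Valued.v (g V₀) = 1 := by
      have hlt : Valued.v (-(f - g V₀)) < Valued.v f := by rw [Valuation.map_neg, hf]; exact hnear.trans_lt hϖn
      rw [show g V₀ = f + -(f - g V₀) by ring, Valuation.map_add_eq_of_lt_left _ hlt, hf]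
    exact ⟨g V₀, mem_image.2 ⟨V₀, mem_filter.2 ⟨hV₀R, hgu⟩, rfl⟩, hnear⟩
  have hS3 : ∀ y ∈ S, ∀ y' ∈ S, Valued.v (y - y') ≤ Valued.v ϖ ^ n → y = y' := by
    intro y hy y' hy' hyy
    obtain ⟨V, hV, rfl⟩ := mem_image.1 hy
    obtain ⟨V', hV', rfl⟩ := mem_image.1 hy'
    have e1 : g V - g V' = γ₁ * (V - V') := by simp only [g]; ring
    rw [e1, map_mul, hγ₁, one_mul] at hyy
    rw [hRd3 V (mem_filter.1 hV).1 V' (mem_filter.1 hV').1 hyy]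
  have h0 := sum_normSign_repr_eq_zero hD h2v hn hAu hAst S hS1 hS2 hS3
  rwa [hSdef, sum_image hg_inj] at h0

/-! ## §2 The digit split: unit-valued digits = (unit sphere ∧ unit-valued) ⊔ (the ball `|V| ≤ |ϖ|²`) -/

/-- **THE DIGIT SPLIT.**  Ramified quadratic datum (only the even-valuation clause and `|ϖ| = exp(−1)` are used); `|α₁| = 1`, `|γ₁| = 1`; `Rd` a finite set of fixed integral
elements.  THEN `Σ_{V ∈ Rd, |α₁ + γ₁V| = 1} φ V = Σ_{V ∈ Rd, |V| = 1 ∧ |α₁ + γ₁V| = 1} φ V + Σ_{V ∈ Rd, |V| ≤ |ϖ|²} φ V` for any summand `φ`: a fixed integral `V` with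
`|V| ≠ 1` has `|V| ≤ |ϖ|²` (even valuation) and then `|α₁ + γ₁V| = |α₁| = 1`. [cite: Serre1979, Ch. V §3 Prop. 5, Cor. 2–3 pp. 84–86] -/
theorem sum_filterUnit_eq_sum_filterSphere_add_sum_filterBall (hD : IsRamifiedQuadraticDatum σ ϖ d t)
    {α₁ γ₁ : K} (hα₁ : Valued.v α₁ = 1) (hγ₁ : Valued.v γ₁ = 1)
    (Rd : Finset K) (hRd1 : ∀ V ∈ Rd, σ V = V ∧ Valued.v V ≤ 1) (φ : K → ℤ) :
    ∑ V ∈ Rd.filter (fun V => Valued.v (α₁ + γ₁ * V) = 1), φ V =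
      ∑ V ∈ Rd.filter (fun V => Valued.v V = 1 ∧ Valued.v (α₁ + γ₁ * V) = 1), φ V +
        ∑ V ∈ Rd.filter (fun V => Valued.v V ≤ Valued.v ϖ ^ 2), φ V := by
  classical
  obtain ⟨-, -, hϖ, hfix, -, -, -⟩ := id hD
  have hϖ2 : Valued.v ϖ ^ 2 = exp (-2 : ℤ) := by rw [hϖ, ← exp_nsmul]; norm_num
  have hϖ2lt : Valued.v ϖ ^ 2 < 1 := by rw [hϖ2, ← exp_zero, exp_lt_exp]; norm_num
  -- small digits are unit-valued
  have hsmall : ∀ V ∈ Rd, Valued.v V ≤ Valued.v ϖ ^ 2 → Valued.v (α₁ + γ₁ * V) = 1 := by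
    intro V _ hV
    have hlt : Valued.v (γ₁ * V) < Valued.v α₁ := by
      rw [map_mul, hγ₁, one_mul, hα₁]; exact hV.trans_lt hϖ2lt
    rw [Valuation.map_add_eq_of_lt_left _ hlt, hα₁]
  -- non-unit fixed integral digits are small
  have hnonunit : ∀ V ∈ Rd, Valued.v V ≠ 1 → Valued.v V ≤ Valued.v ϖ ^ 2 := by
    intro V hV hV1
    obtain ⟨hσV, hVle⟩ := hRd1 V hV
    by_cases hV0 : V = 0
    · rw [hV0, map_zero]; exact zero_le
    obtain ⟨m, hm⟩ := hfix V hσV hV0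
    rw [hm, hϖ2, exp_le_exp]
    rw [hm, ← exp_zero, exp_le_exp] at hVle
    have hne : (2 * m : ℤ) ≠ 0 := fun h => hV1 (by rw [hm, h, exp_zero])
    omega
  rw [← sum_filter_add_sum_filter_not (Rd.filter (fun V => Valued.v (α₁ + γ₁ * V) = 1)) (fun V => Valued.v V = 1), filter_filter, filter_filter]
  congr 1
  · exact sum_congr (filter_congr fun V _ => and_comm) fun _ _ => rfl
  · refine sum_congr (Finset.ext fun V => ?_) fun _ _ => rfl
    simp only [mem_filter]
    constructor
    · rintro ⟨hV, -, hV1⟩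
      exact ⟨hV, hnonunit V hV hV1⟩
    · rintro ⟨hV, hVs⟩
      exact ⟨hV, hsmall V hV hVs, fun hV1 => absurd (hV1 ▸ hVs) (not_le.2 hϖ2lt)⟩

/-! ## §3 HEAD — «THE TOP-SPHERE NX SUM VANISHES» (K6 desk LH4-p16 (g3) WORD #13 (c)) -/

/-- **HEAD — «THE TOP-SPHERE NX SUM VANISHES» (K6 (g-top), K6 desk LH4-p16 (g3) WORD #13 (c): the ONE arithmetic input of the top cell in ★ p864591
`coreWindow_of_cellSums`).**  Ramified quadratic datum `(σ, ϖ; d, t)` on a complete `K` with finite residue field, `|2| < 1`; the TOP-chart label letters `α₁, γ₁` fixed with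
`|α₁| = |γ₁| = 1`; a resolution `n` with `2d − 1 ≤ n` (reaching the conductor); `Rd` ONE complete irredundant system of σ-fixed integral digits modulo `|ϖ|^n` (`hRd1 hRd2 hRd3`,
the letters of ★ p864489 §3 ∕ ★ p863833).  THEN over the unit SPHERE digits whose value is a unit (the level-0 token `NX V :⟺ |α₁ + γ₁·V| = 1`):
**`Σ_{V ∈ Rd.filter (fun V => |V| = 1 ∧ |α₁ + γ₁·V| = 1)} normSign σ (α₁ + γ₁·V) = 0`** — the unit-valued digits sum to zero (§1: all fixed units), the small ball
`|V| ≤ |ϖ|²` sums to zero (★ p864489 §3 at `e = 1, c = 0`: the coset ball `α₁(1 + 𝔭_F)`, using `2 ≤ d` at a wild place, ★ Lit `two_le_of_v_two_lt_one`), and §2 splits.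
[cite: Serre1979, Ch. V §3 Cor. 3 pp. 84–86; Ch. XV §2] [cite: NeukirchANT1999, Ch. V (1.3)] [cite: Kottwitz1986BaseChangeUnits, §1 pp. 240–241]
[cite: Rogawski1990, §4.9 Prop. 4.9.1 (b) p. 55] -/
theorem sum_normSign_affine_topSphere_eq_zero [CompleteSpace K] [Finite 𝓀[K]] (hD : IsRamifiedQuadraticDatum σ ϖ d t) (h2v : Valued.v (2 : K) < 1)
    {α₁ γ₁ : K} (hσα₁ : σ α₁ = α₁) (hα₁ : Valued.v α₁ = 1) (hσγ₁ : σ γ₁ = γ₁) (hγ₁ : Valued.v γ₁ = 1) {n : ℕ} (hn : 2 * d - 1 ≤ n)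
    (Rd : Finset K) (hRd1 : ∀ V ∈ Rd, σ V = V ∧ Valued.v V ≤ 1)
    (hRd2 : ∀ V : K, σ V = V → Valued.v V ≤ 1 → ∃ V₀ ∈ Rd, Valued.v (V - V₀) ≤ Valued.v ϖ ^ n)
    (hRd3 : ∀ V ∈ Rd, ∀ V' ∈ Rd, Valued.v (V - V') ≤ Valued.v ϖ ^ n → V = V') :
    ∑ V ∈ Rd.filter (fun V => Valued.v V = 1 ∧ Valued.v (α₁ + γ₁ * V) = 1), normSign σ (α₁ + γ₁ * V) = 0 := by
  obtain ⟨hσ, hvσ, hϖ, hfix, hd, -, ht⟩ := id hD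
  have h2d : 2 ≤ d := two_le_of_v_two_lt_one hσ hvσ hfix hϖ hd ht h2v
  -- all unit-valued digits: zero (§1)
  have hall := sum_normSign_affine_filterUnit_eq_zero hD h2v hσα₁ hα₁.le hσγ₁ hγ₁ hn Rd hRd1 hRd2 hRd3
  -- the small ball `|V| ≤ |ϖ|²`: zero (★ p864489 §3 at `e = 1`, `c = 0`)
  have hball : ∑ V ∈ Rd.filter (fun V => Valued.v V ≤ Valued.v ϖ ^ 2), normSign σ (α₁ + γ₁ * V) = 0 := by
    have h := sum_normSign_affine_filterBall_eq_zero hD h2v hσα₁ hα₁ hσγ₁ (c := 0) (e := 1) (by rw [hγ₁, mul_zero, pow_zero])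
      (by omega) (by omega) (n := n) (by omega) Rd hRd1 hRd2 hRd3 (by omega)
    simpa only [mul_one] using h
  -- split (§2)
  rw [sum_filterUnit_eq_sum_filterSphere_add_sum_filterBall hD hα₁ hγ₁ Rd hRd1, hball, add_zero] at hall
  exact hall

end Summit.HodgeConjecture.HodgeConjecture.Cruxes.H413.F0P3cDyRamTopSphereLabelSumVanishes

end
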